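/-
Copyright: statement-level skeleton of a published paper (lit-balaban cell, Phase-2 proof seat p25, gen 18). No proof
claims beyond what the kernel checks below.
-/
import Literature.MathematicalPhysics.QuantumFieldTheory.BalabanImbrieJaffe1984to88.BIJ88WalkSplitInstance311

/-!
# `BalabanImbrieJaffe1984to88.BIJ88WalkPieceCount311` — T. Bałaban, J. Imbrie, A. Jaffe, *Effective action and cluster
properties of the abelian Higgs model*, Commun. Math. Phys. **114** (1988) 257–315 [BalabanImbrieJaffe1988], §5.14
p. 310–311 [PDF 54–55], verbatim: *"We give random walk expansions for the propagators … The leading terms … we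
transform further. The others, localized in region X, have a factor of e^{−cr(e_k)|X|}"* — **THE COUNTING WEIGHT OF
THE WALK TERMS SEEING ONE LEG IS SUMMABLE** (p25 gen 18): the locality hypothesis of the local count
(`BIJ88WalkLocalCount312.run_lsum_le`, in the printed-split form of `BIJ88WalkBlockActivityLoc312.flAbsAt_loc_le`:
`1 + Σ_{ω : D_ω u ≠ 0} ρ_ω ≤ ρ₀`) DERIVED from three elementary facts about the random-walk expansion: a walk term
`D_ω` sees the leg `u` only if the walk starts at the cube of `u`; at most `d^n` walks of length `n` start at a given
cube; the counting weight of a walk is `ρ_ω = θ₁^{|ω|}` with `d·θ₁ < 1`.  Then `Σ_{ω : D_ω u ≠ 0} θ₁^{|ω|} ≤ 1/(1 − dθ₁)`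
(a geometric series), uniformly in the number of walks (the volume).

statement-level skeleton of published theorems with citation tags; proofs where landed; nothing here is a claim
about the Yang–Mills mass gap

PDF held: `paper:balaban1988-cmp114-bij-abelian-higgs-effective-action` (journal page = PDF page + 256); p. 310–311 =
PDF 54–55 (`p0054.txt` L24–31, `p0055.txt` L1–22 re-read this session, 2026-08-22).

CITATION HEADER (lean-in-tree rule).  lit-balaban cell (HOME `run/shared/lean/pub/lit-balaban/`), Phase 2, seat p25
gen 18; row **C2.Claim@312** of `HOME/lit-balaban-r16/ROWS-C2-part2.md` (owner r16, referee ref-5; head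
`BIJ88Sect5StatementsPart4.Ineq312` untouched — MEMBER of the row).  USED BY NAME, nothing restated: Mathlib
(`geom_sum_eq`, `Finset.sum_fiberwise_of_maps_to`; the geometric-series bound is re-proved privately, as in several tree files); the hypothesis shape of `BIJ88WalkBlockActivityLoc312.flAbsAt_loc_le`.

## What is proved (0 `sorry`, standard axioms, no new `Prop` facts; theorems only)

* (private `geom_sum_le_inv'`), **`sum_walks_from_le`** (`Σ_{ω : start ω = x} θ₁^{|ω|}
  ≤ 1/(1 − dθ₁)`), **`walk_locality_weight_le`** (`1 + Σ_{ω : D_ω u ≠ 0} θ₁^{|ω|} ≤ 1 + 1/(1 − dθ₁)` when the walk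
  terms seeing `u` start at the cube of `u`).
HONEST SCOPE: the three facts (start at the cube of the leg, `≤ d^n` walks of length `n`, weight `θ₁^{|ω|}`) are
HYPOTHESES about the random-walk expansion of §5.13/§5.14 p.310, not derived from it; no `Ineq312` binder.  NOT summit
progress; NOT continuum; NOT Clay.  Imports `BIJ88WalkSplitInstance311`; modifies nothing.
-/

noncomputable section

namespace Literature.MathematicalPhysics.QuantumFieldTheory.BalabanImbrieJaffe1984to88.BIJ88WalkPieceCount311

open Classical Matrix Finset
open scoped BigOperators

/-- `Σ_{n<N} r^n ≤ 1/(1 − r)` for `0 ≤ r < 1` (bookkeeping; cf. the tree's `geom_sum_le_inv_one_sub`). [folklore] -/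
private theorem geom_sum_le_inv' {r : ℝ} (hr0 : 0 ≤ r) (hr1 : r < 1) (N : ℕ) : ∑ n ∈ range N, r ^ n ≤ 1 / (1 - r) := by
  have h1 : 0 < 1 - r := sub_pos.2 hr1
  rw [geom_sum_eq hr1.ne N, le_div_iff₀ h1]
  have h2 : r - 1 ≠ 0 := ne_of_lt (by linarith)
  have e : (r ^ N - 1) / (r - 1) * (1 - r) = 1 - r ^ N := by
    rw [show (1 - r) = -(r - 1) by ring, mul_neg, div_mul_cancel₀ _ h2]
    ring
  rw [e]
  linarith [pow_nonneg hr0 N]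

/-- **THE WALKS FROM ONE CUBE ARE SUMMABLE**: if at most `d^n` walks of length `n` start at the cube `x` and
`0 ≤ θ₁`, `dθ₁ < 1`, then `Σ_{ω : start ω = x} θ₁^{|ω|} ≤ 1/(1 − dθ₁)` — whatever the (finite) set of walks.
[cite: BalabanImbrieJaffe1988, §5.14 p.310] -/
theorem sum_walks_from_le {Ω β : Type} [Fintype Ω] (start : Ω → β) (len : Ω → ℕ) {d θ₁ : ℝ} (hd : 0 ≤ d)
    (hθ : 0 ≤ θ₁) (hlt : d * θ₁ < 1)
    (hcount : ∀ n : ℕ, ∀ x : β, (((univ : Finset Ω).filter fun ω => start ω = x ∧ len ω = n).card : ℝ) ≤ d ^ n)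
    (x : β) :
    ∑ ω ∈ (univ : Finset Ω).filter (fun ω => start ω = x), θ₁ ^ len ω ≤ 1 / (1 - d * θ₁) := by
  -- group the walks by their length
  obtain ⟨N, hN⟩ : ∃ N, ∀ ω : Ω, len ω < N :=
    ⟨(univ : Finset Ω).sup len + 1, fun ω => Nat.lt_succ_of_le (Finset.le_sup (Finset.mem_univ ω))⟩
  have hmaps : ∀ ω ∈ (univ : Finset Ω).filter (fun ω => start ω = x), len ω ∈ range N :=
    fun ω _ => Finset.mem_range.2 (hN ω)
  rw [← Finset.sum_fiberwise_of_maps_to hmaps]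
  refine le_trans (Finset.sum_le_sum fun n _ => ?_) (geom_sum_le_inv' (mul_nonneg hd hθ) hlt N)
  -- the walks of length `n` from `x`: at most `d^n`, each weighing `θ₁^n`
  have e : ∑ ω ∈ ((univ : Finset Ω).filter fun ω => start ω = x).filter (fun ω => len ω = n), θ₁ ^ len ω
      = (((univ : Finset Ω).filter fun ω => start ω = x ∧ len ω = n).card : ℝ) * θ₁ ^ n := by
    rw [Finset.filter_filter]
    rw [Finset.sum_congr rfl fun ω hω => by rw [(Finset.mem_filter.1 hω).2.2], Finset.sum_const, nsmul_eq_mul]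
  rw [e, mul_pow]
  exact mul_le_mul_of_nonneg_right (hcount n x) (pow_nonneg hθ _)

/-- **THE LOCALITY WEIGHT OF THE PRINTED SPLIT**: if a walk term `D_ω` sees the leg `u` (`D_ω u ≠ 0`) only when the
walk starts at the cube `lc u` of `u`, at most `d^n` walks of length `n` start at any cube, and `0 ≤ θ₁`, `dθ₁ < 1`,
then `1 + Σ_{ω : D_ω u ≠ 0} θ₁^{|ω|} ≤ 1 + 1/(1 − dθ₁)` — the hypothesis `hρ₀` of
`BIJ88WalkBlockActivityLoc312.flAbsAt_loc_le` with `ρ_ω = θ₁^{|ω|}`, `ρ₀ = 1 + 1/(1 − dθ₁)`, uniformly in the volume.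
[cite: BalabanImbrieJaffe1988, §5.14 p.310–311] -/
theorem walk_locality_weight_le {S Ω β : Type} [Fintype S] [Fintype Ω] {D : Ω → Matrix S S ℝ} (start : Ω → β)
    (len : Ω → ℕ) (lc : (S → ℝ) → β) {d θ₁ : ℝ} (hd : 0 ≤ d) (hθ : 0 ≤ θ₁) (hlt : d * θ₁ < 1)
    (hcount : ∀ n : ℕ, ∀ x : β, (((univ : Finset Ω).filter fun ω => start ω = x ∧ len ω = n).card : ℝ) ≤ d ^ n)
    (hsee : ∀ ω u, D ω *ᵥ u ≠ 0 → start ω = lc u) (u : S → ℝ) :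
    1 + ∑ ω ∈ (univ : Finset Ω).filter (fun ω => D ω *ᵥ u ≠ 0), θ₁ ^ len ω ≤ 1 + 1 / (1 - d * θ₁) := by
  refine add_le_add le_rfl (le_trans ?_ (sum_walks_from_le start len hd hθ hlt hcount (lc u)))
  exact Finset.sum_le_sum_of_subset_of_nonneg
    (fun ω hω => Finset.mem_filter.2 ⟨Finset.mem_univ _, hsee ω u (Finset.mem_filter.1 hω).2⟩)
    fun ω _ _ => pow_nonneg hθ _

end Literature.MathematicalPhysics.QuantumFieldTheory.BalabanImbrieJaffe1984to88.BIJ88WalkPieceCount311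

end
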